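import Summits.CriticalPhenomena.PercolationContinuityZ3.Theorems.Transplant.FKConnectivityAllQTwoClusterRayleighSquare
import HarnessLib

/-!
# The q-GRADED two-cluster Rayleigh square (node `TwoClusterRayleighGradedPos`, NOT asserted): `Z₁₀(q)Z₀₁(q) − Z₁₁(q)Z₀₀(q) − q⁻²W(q)²`
# coefficientwise in `(x, y, q)` for the `a ↮ c`-restricted random-cluster partition functions; kernel: its `q²`-slice IS Conjecture R
# (`rayleighFibreOn_of_gradedOn`), hence ⇒ OSNC ⇒ EDOM ⇒ CA₂ ⇒ FP2; its lowest slice is coefficientwise FOREST Rayleigh at an ADJACENT pair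

Support file (`--supports stmt-CriticalPhenomena-4575`), FK sub-lane `prim-bschramm-fk-1` (gen 16) of the post-continuity programme;
builds on p205010 (kernel theorem, internal audit signed; external expert review pending).  Definitions (one event, one counting
function, one counting predicate, one `@[conjecture]` node — NOT asserted), no named facts, no sorries; standard axioms.

SETTING (`…TwoClusterRayleighSquare.lean`, fk-1 g15).  Finite vertex type `V`, all pairs weighted; seeds `a, c`; `e = uv` with `u`
sure-joined to `a`, `f = xy` with `x` sure-joined to `c` (simplest case `u = a`, `x = c`); configurations `ω` with `e, f ∉ ω`.  Conjecture R
(node `TwoClusterRayleighFibreOn`) is the fibrewise (= coefficientwise) statement `Z₁₀Z₀₁ − Z₁₁Z₀₀ − W² ≥ 0` for the masses of the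
TWO-CLUSTER event `E = {a ↮ c} ∩ {k = 2}` in the four pinned worlds and the three-cluster class `𝒲 = (a | vy | c)`.
THE GRADED NODE (Conjecture R_q, memo bschramm/FROM-fk-1-g15-RAYLEIGH-SQUARE.md §1c).  Replace `E` by the bare separation event
`D = {a ↮ c}` (ANY number of clusters) and grade every pair of configurations by its TOTAL cluster count: for a folding fibre `(M, u₀)` and
`s ∈ ℕ` put (all configurations guarded by `e, f ∉ ω`)
`bad(s)  = Σ_{i+j=s} #{ω : ω ∪ {e,f} ∈ D ∩ L_i, ω ∆ M ∈ D ∩ L_j}`,   `good(s) = Σ_{i+j=s} #{ω : ω ∪ {e} ∈ D ∩ L_i, (ω ∆ M) ∪ {f} ∈ D ∩ L_j}`,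
`sq(t)   = Σ_{i+j=t} #{ω : ω ∈ 𝒜 ∩ L_i, ω ∆ M ∈ 𝒜 ∩ L_j}`,  `𝒜 = threeArmEv a c v y = {a, c, v pairwise separated, v ~ y}` (any `k`),
where `L_j = {k(ω) = j}` (`levelSet`).  The node `TwoClusterRayleighGradedOn V`: **`bad(s) + sq(s+2) ≤ good(s)` for every fibre whose common
part joins `a ~ u`, `c ~ x`, and every `s`** — i.e. `Z₁₀(q)Z₀₁(q) − Z₁₁(q)Z₀₀(q) − q⁻²W(q)²` has nonnegative coefficients as a polynomial in
the pair variables AND `q`, where `Z_{ij}(q) = Σ_{ω ∪ pins ∈ D} x^ω y^{ωᶜ} q^{k(ω ∪ pins)}` are the `a ↮ c`-restricted random-cluster partition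
functions of the four pinned worlds and `W(q)` that of `𝒜`.
SLICES.  (i) `s = 4` (the lowest possible total count under `a ↮ c`): both configurations have exactly two clusters and `sq(6)` counts
pairs of exactly-three-cluster configurations, so the slice is LITERALLY Conjecture R: **`rayleighFibreOn_of_gradedOn`**; hence
(`…_of_gradedPos`) OSNC, edge dominance, positive association of the two-cluster law and the two-cluster four-point inequality.
(ii) Summing the slices against `q^s` gives, for every `q > 0` and all weights, `Z₁₁Z₀₀ + q⁻²W² ≤ Z₁₀Z₀₁` for `φ_{w,q}` restricted to
`{a ↮ c}` — opposite-seed edge negative correlation for the random-cluster measure CONDITIONED ON `a ↮ c` at every `q`: for `q ≥ 1` a consequence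
of van den Berg–Häggström–Kahn's Thm. 2.1 (tree: `fkCrossNegAssocOn_of_one_le`), for `q < 1` an instance of the node `FKCrossNegAssocPos`
(the weighted form is typed in the companion file `…TwoClusterRayleighGradedRC.lean`).
(iii) THE LOWEST SLICE IN THE FULL-BIPARTITION FIBRE (`u₀ = ∅`, `M` = all pairs of a graph `H`; `s = 2|V| − |M| − 2`) counts pairs of
COMPLEMENTARY FORESTS: it is the coefficient of `x^{E(H)}` in `F_e^f F_f^e − F_{ef}F^{ef} − X²` for the spanning-FOREST polynomial `F` of
`H/{a=c}` (all forests, any number of trees) at the ADJACENT pair `e = ov`, `f = oy` (`o` = the merged vertex), `X` = forests with `o ∤ v`,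
`o ∤ y`, `v ~ y`.  In pattern form: `N(0,OVY) ≤ N(OV,OY) + N(OY,VY) + N(VY,OV) + N(0,VY)`, `N(π,π')` = number of ordered partitions of
`E(H/{a=c})` into two forests inducing the partitions `π, π'` of `{o,v,y}`.  So the graded node CONTAINS coefficientwise ("strong")
Rayleigh monotonicity of uniform / `q`-weighted spanning forests (the arboreal gas) for ADJACENT edges — an open relative of the
Grimmett–Winkler / Pemantle / Kahn forest conjecture (Semple–Welsh 2008 Conj. 1.1; open since the early 1990s); for NON-adjacent pairs the
coefficientwise form is FALSE already on `K₄` (Semple–Welsh Thm. 4.2: `M(K₄)` is not strongly independence-correlated; fk-1 g16 recount: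
full-bipartition coefficient `2 − 4 < 0` for two disjoint edges of `K₄`), while for adjacent pairs it holds in every census below.
EVIDENCE (exact integer counts; fk-1 g15 numerics/qcoef2.py, kit j140704; fk-1 g16 numerics/fpat.c): graded node 0 negatives in 2,104,800
(n = 5, all graphs) + 25,574,109 (n = 6, 27,005 instances) + 11,497,692 (n = 6 multigraphs) + 29,724,671 (n = 7) + 9,454,410 (n = 8)
(fibre, s)-cells; forest slice (pattern form) 0 failures on ALL simple graphs with ≤ 6 vertices (3,204,480 placements (H, o, v, y)), all
multigraphs with ≤ 6 vertices, multiplicity ≤ 2, ≤ 9 edges (50,355,120), tight (equality) in 93 % of them.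
[cite: CibulkaHladkyLaCroixWagner2008, Thm. 1 (p. 2)] [cite: SempleWelsh2008, Conj. 1.1 (p. 2); Thm. 4.2 (p. 11)]
[cite: Grimmett2006, §1.4 eq. (1.20) (p. 15); §3.9 eq. (3.94) (p. 63)] [cite: VandenbergHaggstromKahn2005, Thm. 1.4 (p. 7); Thm. 2.1 (p. 9)]
[cite: Linusson2011, Prop. 2.6]
-/

noncomputable section

namespace Summit.CriticalPhenomena.PercolationContinuityZ3.Theorems

namespace FK

open MeasureTheory Set Literature.Probability.LatticeModels Literature.Probability.Percolation
open scoped Classical symmDiff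

variable {V : Type*} [Fintype V]

/-! ### The three-arm event and graded fibre counts -/

/-- **The three-arm event `𝒜 = (a | vy | c)` with any number of clusters**: `a, c, v` pairwise separated and `v ~ y`; its slice of
exactly three clusters is fk-1 g15's `threeClusterEv`. [cite: CibulkaHladkyLaCroixWagner2008, Thm. 1 (p. 2)] [cite: Grimmett2006, §1.2 eq. (1.1) (p. 4)] -/
def threeArmEv (a c v y : V) : Set (BondConfig V) :=
  {ω | ¬ (openGraph ω).Reachable a c ∧ ¬ (openGraph ω).Reachable a v ∧ ¬ (openGraph ω).Reachable c v ∧ (openGraph ω).Reachable v y}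

/-- `threeClusterEv = threeArmEv ∩ L₃`. [cite: Grimmett2006, §1.2 eq. (1.1) (p. 4)] -/
theorem threeArmEv_inter_levelSet_three (a c v y : V) : threeArmEv a c v y ∩ levelSet V 3 = threeClusterEv a c v y := by
  ext ω
  simp only [threeArmEv, threeClusterEv, levelSet, mem_inter_iff, mem_setOf_eq, and_assoc]

/-- **Graded pair count**: `Σ_{i+j=s} #{ω on the fibre (M,u) : ω ∈ A i, ω ∆ M ∈ B j}` over levels `i, j ≤ |V|` — the coefficient of
`q^s` (and of the fibre's monomial) in the product of two level-graded generating functions. [cite: Linusson2011, Prop. 2.6]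
[cite: Grimmett2006, §1.4 eq. (1.20) (p. 15)] -/
def gradedCount (M u : BondConfig V) (A B : ℕ → Set (BondConfig V)) (s : ℕ) : ℕ :=
  ∑ i ∈ Finset.range (Fintype.card V + 1), ∑ j ∈ Finset.range (Fintype.card V + 1), if i + j = s then fibreCount M u (A i) (B j) else 0

/-! ### The node -/

/-- **The q-graded two-cluster Rayleigh square on the vertex type `V`** (Conjecture R_q, fibre form): for every fibre `(M, u₀)` whose
common part joins `a ~ u` and `c ~ x`, every `s`, with `e = uv`, `f = xy` kept outside the configurations and `D = {a ↮ c}`,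
`Σ_{i+j=s} #{ω∪{e,f} ∈ D∩L_i, ω∆M ∈ D∩L_j} + Σ_{i+j=s+2} #{ω ∈ 𝒜∩L_i, ω∆M ∈ 𝒜∩L_j} ≤ Σ_{i+j=s} #{ω∪{e} ∈ D∩L_i, (ω∆M)∪{f} ∈ D∩L_j}`.
[cite: CibulkaHladkyLaCroixWagner2008, Thm. 1 (p. 2)] [cite: Grimmett2006, §1.4 eq. (1.20) (p. 15)] [cite: Linusson2011, Prop. 2.6] -/
def TwoClusterRayleighGradedOn (V : Type*) [Fintype V] : Prop :=
  ∀ (M u₀ : BondConfig V), Disjoint u₀ M → ∀ (a c u v x y : V) (s : ℕ),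
    (openGraph u₀).Reachable a u → (openGraph u₀).Reachable c x →
    gradedCount M u₀ (fun i => {ω | s(u, v) ∉ ω ∧ s(x, y) ∉ ω} ∩ {ω | insert s(x, y) (insert s(u, v) ω) ∈ sepEv a c ∩ levelSet V i})
        (fun j => {ω | s(u, v) ∉ ω ∧ s(x, y) ∉ ω} ∩ (sepEv a c ∩ levelSet V j)) s +
      gradedCount M u₀ (fun i => {ω | s(u, v) ∉ ω ∧ s(x, y) ∉ ω} ∩ (threeArmEv a c v y ∩ levelSet V i))
        (fun j => {ω | s(u, v) ∉ ω ∧ s(x, y) ∉ ω} ∩ (threeArmEv a c v y ∩ levelSet V j)) (s + 2) ≤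
      gradedCount M u₀ (fun i => {ω | s(u, v) ∉ ω ∧ s(x, y) ∉ ω} ∩ {ω | insert s(u, v) ω ∈ sepEv a c ∩ levelSet V i})
        (fun j => {ω | s(u, v) ∉ ω ∧ s(x, y) ∉ ω} ∩ {ω | insert s(x, y) ω ∈ sepEv a c ∩ levelSet V j}) s

/-- **Conjecture R_q on every finite vertex type.**  CONJECTURE-SHAPED COUNTING STATEMENT, NOT asserted.  Evidence: 0 negative
(fibre, s)-cells in 2.1·10⁶ (n = 5, all graphs), 2.6·10⁷ + 1.1·10⁷ (n = 6, simple + multi), 3.0·10⁷ (n = 7), 9.5·10⁶ (n = 8) exact cells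
(fk-1 g15 kit j140704); its `s = 4` slice is Conjecture R (`rayleighFibreOn_of_gradedOn`), its lowest full-bipartition slice is
coefficientwise forest Rayleigh at an adjacent pair (0 failures on all graphs with ≤ 6 vertices, fk-1 g16).
[cite: CibulkaHladkyLaCroixWagner2008, Thm. 1 (p. 2)] [cite: SempleWelsh2008, Conj. 1.1 (p. 2)] -/
@[conjecture] def TwoClusterRayleighGradedPos : Prop := ∀ n : ℕ, TwoClusterRayleighGradedOn (Fin n)

/-! ### Levels forced by separation -/

/-- **Three pairwise separated vertices force at least three open clusters.** [cite: Grimmett2006, §1.2 eq. (1.1) (p. 4)] -/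
theorem three_le_clusterCount_of_pairwise_not_reachable {ω : BondConfig V} {a c v : V} (hac : ¬ (openGraph ω).Reachable a c)
    (hav : ¬ (openGraph ω).Reachable a v) (hcv : ¬ (openGraph ω).Reachable c v) : 3 ≤ clusterCount ω ∅ := by
  unfold clusterCount
  have hG : openGraph ω ⊔ wired (∅ : Set V) = openGraph ω := by rw [wired_empty, sup_bot_eq]
  rw [hG]
  set G := openGraph ω
  let φ : Fin 3 → G.ConnectedComponent := ![G.connectedComponentMk a, G.connectedComponentMk c, G.connectedComponentMk v]
  have hφ : Function.Injective φ := by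
    intro i j hij
    fin_cases i <;> fin_cases j
    all_goals simp only [φ, Fin.zero_eta, Fin.mk_one, Fin.reduceFinMk, Matrix.cons_val_zero, Matrix.cons_val_one, Matrix.cons_val,
      SimpleGraph.ConnectedComponent.eq] at hij
    all_goals first
      | rfl
      | exact absurd hij hac | exact absurd hij.symm hac
      | exact absurd hij hav | exact absurd hij.symm hav
      | exact absurd hij hcv | exact absurd hij.symm hcv
  have := Nat.card_le_card_of_injective φ hφ
  simpa using this

/-- The three-arm event misses the levels `0, 1, 2`. [cite: Grimmett2006, §1.2 eq. (1.1) (p. 4)] -/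
theorem threeArmEv_inter_levelSet_eq_empty (a c v y : V) {j : ℕ} (hj : j < 3) : threeArmEv a c v y ∩ levelSet V j = ∅ := by
  ext ω
  simp only [mem_inter_iff, mem_empty_iff_false, iff_false, not_and]
  rintro ⟨hac, hav, hcv, -⟩ hL
  rw [mem_levelSet_iff] at hL
  have := three_le_clusterCount_of_pairwise_not_reachable hac hav hcv
  omega

/-- `{a ↮ c}` misses the levels `0, 1`. [cite: Grimmett2006, §1.2 eq. (1.1) (p. 4)] -/
theorem sepEv_inter_levelSet_eq_empty (a c : V) {j : ℕ} (hj : j < 2) : sepEv a c ∩ levelSet V j = (∅ : Set (BondConfig V)) :=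
  inter_levelSet_eq_empty_of_subset_sepEv (subset_refl _) hj

omit [Fintype V] in
/-- A fibre count with an empty first event vanishes. [cite: Linusson2011, Prop. 2.6] -/
theorem fibreCount_eq_zero_of_left [Fintype V] (M u : BondConfig V) {A : Set (BondConfig V)} (hA : A = ∅) (B : Set (BondConfig V)) :
    fibreCount M u A B = 0 := by
  unfold fibreCount
  rw [Finset.card_eq_zero, Finset.filter_eq_empty_iff]
  rintro ω - ⟨-, hω, -⟩
  rw [hA] at hω
  exact hω

omit [Fintype V] in
/-- A fibre count with an empty second event vanishes. [cite: Linusson2011, Prop. 2.6] -/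
theorem fibreCount_eq_zero_of_right [Fintype V] (M u : BondConfig V) (A : Set (BondConfig V)) {B : Set (BondConfig V)} (hB : B = ∅) :
    fibreCount M u A B = 0 := by
  unfold fibreCount
  rw [Finset.card_eq_zero, Finset.filter_eq_empty_iff]
  rintro ω - ⟨-, -, hω⟩
  rw [hB] at hω
  exact hω

omit [Fintype V] in
/-- Guarding or pulling back the empty event gives the empty event. [folklore] -/
theorem guard_inter_preimage_empty (G : Set (BondConfig V)) (g : BondConfig V → BondConfig V) {X : Set (BondConfig V)} (hX : X = ∅) :
    G ∩ {ω | g ω ∈ X} = ∅ := by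
  rw [hX]; ext ω; simp

/-- **Evaluation of a graded count concentrated on one level pair**: if `A i = ∅` for `i < m` and `B j = ∅` for `j < m`, then the graded
count at `s = 2m` is the single fibre count `#(A m, B m)` (levels above `|V|` being empty is not needed: the hypothesis `m ≤ |V|` puts
`(m, m)` in range). [cite: Linusson2011, Prop. 2.6] -/
theorem gradedCount_eq_fibreCount_of_vanishing (M u : BondConfig V) (A B : ℕ → Set (BondConfig V)) {m : ℕ} (hm : m ≤ Fintype.card V)
    (hA : ∀ i < m, A i = ∅) (hB : ∀ j < m, B j = ∅) : gradedCount M u A B (2 * m) = fibreCount M u (A m) (B m) := by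
  unfold gradedCount
  have hmr : m ∈ Finset.range (Fintype.card V + 1) := Finset.mem_range.2 (Nat.lt_succ_of_le hm)
  rw [Finset.sum_eq_single_of_mem m hmr]
  · rw [Finset.sum_eq_single_of_mem m hmr]
    · rw [if_pos (by ring)]
    · intro j _ hj
      by_cases hij : m + j = 2 * m
      · rw [if_pos hij]; omega
      · rw [if_neg hij]
  · intro i _ hi
    refine Finset.sum_eq_zero fun j _ => ?_
    by_cases hij : i + j = 2 * m
    · rw [if_pos hij]
      rcases lt_or_gt_of_ne hi with h | h
      · exact fibreCount_eq_zero_of_left M u (hA i h) _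
      · exact fibreCount_eq_zero_of_right M u _ (hB j (by omega))
    · rw [if_neg hij]

/-! ### The `q²`-slice of the graded node is Conjecture R -/

/-- **The `s = 4` slice of Conjecture R_q is Conjecture R**: `TwoClusterRayleighGradedOn V → TwoClusterRayleighFibreOn V`.
[cite: CibulkaHladkyLaCroixWagner2008, Thm. 1 (p. 2)] [cite: Linusson2011, Prop. 2.6] -/
theorem rayleighFibreOn_of_gradedOn (h : TwoClusterRayleighGradedOn V) : TwoClusterRayleighFibreOn V := by
  intro M u₀ hd a c u v x y hau hcx
  have key := h M u₀ hd a c u v x y 4 hau hcx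
  set Gd : Set (BondConfig V) := {ω | s(u, v) ∉ ω ∧ s(x, y) ∉ ω} with hGd
  by_cases hV : 3 ≤ Fintype.card V
  · -- the three graded counts are single fibre counts at the level pairs (2,2), (3,3), (2,2)
    rw [show (4 : ℕ) = 2 * 2 from rfl, show 2 * 2 + 2 = 2 * 3 from rfl,
      gradedCount_eq_fibreCount_of_vanishing M u₀ _ _ (show 2 ≤ Fintype.card V by omega)
        (fun i hi => guard_inter_preimage_empty Gd _ (sepEv_inter_levelSet_eq_empty a c hi))
        (fun j hj => by rw [sepEv_inter_levelSet_eq_empty a c hj, inter_empty]),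
      gradedCount_eq_fibreCount_of_vanishing M u₀ _ _ hV
        (fun i hi => by rw [threeArmEv_inter_levelSet_eq_empty a c v y hi, inter_empty])
        (fun j hj => by rw [threeArmEv_inter_levelSet_eq_empty a c v y hj, inter_empty]),
      gradedCount_eq_fibreCount_of_vanishing M u₀ _ _ (show 2 ≤ Fintype.card V by omega)
        (fun i hi => guard_inter_preimage_empty Gd _ (sepEv_inter_levelSet_eq_empty a c hi))
        (fun j hj => guard_inter_preimage_empty Gd _ (sepEv_inter_levelSet_eq_empty a c hj)),
      threeArmEv_inter_levelSet_three] at key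
    exact key
  · -- fewer than three vertices: the two-cluster and three-cluster events in play are empty or the inequality is the graded one verbatim
    rw [not_le] at hV
    by_cases hV2 : Fintype.card V = 2
    · -- levels ≥ 3 are empty, so the square term vanishes on both sides; the rest is the (2,2) evaluation
      have h3 : threeClusterEv a c v y = (∅ : Set (BondConfig V)) := by
        rw [← threeArmEv_inter_levelSet_three]
        ext ω
        simp only [mem_inter_iff, mem_levelSet_iff, mem_empty_iff_false, iff_false, not_and]
        intro _ hk
        have := clusterCount_empty_le_card ω
        omega
      rw [show (4 : ℕ) = 2 * 2 from rfl,
        gradedCount_eq_fibreCount_of_vanishing M u₀ _ _ (show 2 ≤ Fintype.card V by omega)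
          (fun i hi => guard_inter_preimage_empty Gd _ (sepEv_inter_levelSet_eq_empty a c hi))
          (fun j hj => by rw [sepEv_inter_levelSet_eq_empty a c hj, inter_empty]),
        gradedCount_eq_fibreCount_of_vanishing M u₀ _ _ (show 2 ≤ Fintype.card V by omega)
          (fun i hi => guard_inter_preimage_empty Gd _ (sepEv_inter_levelSet_eq_empty a c hi))
          (fun j hj => guard_inter_preimage_empty Gd _ (sepEv_inter_levelSet_eq_empty a c hj))] at key
      rw [h3, inter_empty, fibreCount_eq_zero_of_left M u₀ rfl, add_zero]
      exact le_trans (Nat.le_add_right _ _) key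
    · -- at most one vertex: `{a ↮ c} = ∅` since `a = c`
      have h1 : Fintype.card V ≤ 1 := by omega
      have hac : a = c := Fintype.card_le_one_iff.1 h1 a c
      have hsep : sepEv a c = (∅ : Set (BondConfig V)) := by
        ext ω; simp only [mem_sepEv_iff, hac, SimpleGraph.Reachable.refl, not_true_eq_false, mem_empty_iff_false]
      have h2 : twoClusterEv a c = (∅ : Set (BondConfig V)) := by rw [twoClusterEv, hsep, empty_inter]
      have h3 : threeClusterEv a c v y = (∅ : Set (BondConfig V)) := by
        ext ω
        simp only [threeClusterEv, mem_setOf_eq, mem_empty_iff_false, iff_false, not_and, hac]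
        intro h _ _ _ _; exact h SimpleGraph.Reachable.rfl
      rw [h3, inter_empty, fibreCount_eq_zero_of_left M u₀ rfl, add_zero, guard_inter_preimage_empty _ _ h2,
        fibreCount_eq_zero_of_left M u₀ rfl]
      exact Nat.zero_le _

/-- **`TwoClusterRayleighGradedPos → TwoClusterRayleighFibrePos`.** [cite: CibulkaHladkyLaCroixWagner2008, Thm. 1 (p. 2)] -/
theorem rayleighFibrePos_of_gradedPos (h : TwoClusterRayleighGradedPos) : TwoClusterRayleighFibrePos :=
  fun n => rayleighFibreOn_of_gradedOn (h n)

/-- **`TwoClusterRayleighGradedPos → TwoClusterSeedNegCorrPos`** (OSNC). [cite: Grimmett2006, §3.9 eq. (3.94) (p. 63)] -/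
theorem twoClusterSeedNegCorrPos_of_gradedPos (h : TwoClusterRayleighGradedPos) : TwoClusterSeedNegCorrPos :=
  twoClusterSeedNegCorrPos_of_rayleighFibrePos (rayleighFibrePos_of_gradedPos h)

/-- **`TwoClusterRayleighGradedPos → TwoClusterEdgeDomPos`.** [cite: Grimmett2006, §3.9 (pp. 63–65)] -/
theorem twoClusterEdgeDomPos_of_gradedPos (h : TwoClusterRayleighGradedPos) : TwoClusterEdgeDomPos :=
  twoClusterEdgeDomPos_of_rayleighFibrePos (rayleighFibrePos_of_gradedPos h)

/-- **`TwoClusterRayleighGradedPos → TwoClusterAssocPos`** (positive association of the two-cluster law).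
[cite: VandenbergHaggstromKahn2005, Thm. 1.5 (p. 7)] -/
theorem twoClusterAssocPos_of_gradedPos (h : TwoClusterRayleighGradedPos) : TwoClusterAssocPos :=
  twoClusterAssocPos_of_rayleighFibrePos (rayleighFibrePos_of_gradedPos h)

/-- **`TwoClusterRayleighGradedPos → TwoClusterFourPointPos`** (the two-cluster four-point inequality).
[cite: KozmaNitzan2024, Thm. 1, eq. (6) (pp. 7–8)] -/
theorem twoClusterFourPointPos_of_gradedPos (h : TwoClusterRayleighGradedPos) : TwoClusterFourPointPos :=
  twoClusterFourPointPos_of_rayleighFibrePos (rayleighFibrePos_of_gradedPos h)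

end FK

end Summit.CriticalPhenomena.PercolationContinuityZ3.Theorems

end
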